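import Mathlib.AlgebraicGeometry.Limits
import Mathlib.AlgebraicGeometry.Morphisms.Separated
import HarnessLib

/-!
# A reduced scheme covered by finitely many pairwise disjoint closed subschemes is their coproduct

Topic `Literature/AlgebraicGeometry/Morphisms`, namespace `Literature.AlgebraicGeometry.Morphisms`. PROOF FILE (theorems only;
no definition, no named fact, no instance, no `sorry`).

Let `S` be a REDUCED scheme and `(κ_i : Z_i ⟶ S)_{i ∈ σ}` a FINITE family of closed immersions whose images are pairwise disjoint
and cover `S`.  Then:

* `isOpen_range_of_finite_disjoint_closed_cover` — each image is open (its complement is the finite union of the other closed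
  images);
* `isOpenImmersion_of_isClosedImmersion_of_isOpen_range` — a closed immersion with OPEN image into a reduced scheme is an open
  immersion: it factors through the open subscheme `U` on its image by a surjective closed immersion into the reduced `U`, which is
  an isomorphism (Mathlib `isIso_of_isClosedImmersion_of_surjective`);
* `nonempty_isColimit_cofan_of_isClosedImmersion` — hence `S ≅ ∐_i Z_i`: the cofan `(κ_i)` is a COLIMIT (Mathlib
  `nonempty_isColimit_cofanMk_of` for pairwise disjoint covering open immersions);
* `nonempty_isColimit_cofan_over_of_isClosedImmersion` — the same for a cofan in `Over B` (e.g. `SchemeOver k`): `Over.forget B`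
  creates, hence reflects, the coproduct.

This is the elementary fact «a reduced scheme which is set-theoretically the disjoint union of finitely many closed subschemes is
scheme-theoretically their disjoint union» ([GortzWedhorn2020] §(3.5) Prop. 3.10 / Example 3.11 with the reduced-subscheme structure
§(3.18); [StacksProject, Tag 0F2M]).  Consumer (cell hodgecm-mathlib, road (ii) L3.6 F-COFAN): the complex fibre of the descended
unitary Shimura curve `(M⋆_{K⋆})_τ` — reduced, with underlying space the disjoint union of the closed special curves `Z_{q,i}` of the
surface pieces — is the coproduct `∐ Z_{q,i}`, whence its `pieces` clause.

## References
* [GortzWedhorn2020] U. Görtz, T. Wedhorn, *Algebraic Geometry I* (2nd ed. 2020), §(3.5) Prop. 3.10, Example 3.11; §(3.18).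
* [StacksProject] The Stacks project, Tag 0F2M (a scheme whose underlying space is a finite disjoint union of clopens), Tag 01J3.
-/

set_option autoImplicit false

noncomputable section

open CategoryTheory CategoryTheory.Limits AlgebraicGeometry Set Function

namespace Literature.AlgebraicGeometry.Morphisms

open _root_.Topology

universe u

/-! ### §1. Topology: the images are open -/

/-- In a FINITE cover of a space by pairwise disjoint closed sets, every member is open (its complement is the finite union of the
others). [cite: StacksProject, Tag 0F2M] -/
theorem isOpen_of_finite_disjoint_closed_cover {α : Type*} [TopologicalSpace α] {σ : Type*} [Finite σ] (C : σ → Set α)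
    (hclosed : ∀ i, IsClosed (C i)) (hdisj : Pairwise (Disjoint on C)) (hcov : ⋃ i, C i = univ) (i : σ) : IsOpen (C i) := by
  have hcompl : (C i)ᶜ = ⋃ j ∈ {j | j ≠ i}, C j := by
    ext x
    simp only [mem_compl_iff, mem_iUnion, mem_setOf_eq, exists_prop]
    constructor
    · intro hx
      have hxU : x ∈ ⋃ j, C j := by rw [hcov]; exact mem_univ x
      obtain ⟨j, hj⟩ := mem_iUnion.1 hxU
      exact ⟨j, fun h => hx (h ▸ hj), hj⟩
    · rintro ⟨j, hji, hj⟩ hxi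
      exact Set.disjoint_left.1 (hdisj hji) hj hxi
  rw [← isClosed_compl_iff, hcompl]
  exact (Set.toFinite _).isClosed_biUnion fun j _ => hclosed j

/-! ### §2. A closed immersion with open image into a reduced scheme is an open immersion -/

/-- **A closed immersion with OPEN image into a REDUCED scheme is an open immersion**: it factors through the open subscheme `U`
on its image by a surjective closed immersion into the reduced scheme `U`, an isomorphism.
[cite: GortzWedhorn2020, §(3.18) and §(3.5) Prop. 3.10] -/
theorem isOpenImmersion_of_isClosedImmersion_of_isOpen_range {Z S : Scheme.{u}} (κ : Z ⟶ S) [IsClosedImmersion κ] [IsReduced S]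
    (hopen : IsOpen (Set.range κ.base)) : IsOpenImmersion κ := by
  set U : S.Opens := ⟨Set.range κ.base, hopen⟩ with hU
  have hrange : Set.range κ.base ⊆ Set.range U.ι.base := by
    rw [Scheme.Opens.range_ι]; exact subset_rfl
  set κ' := IsOpenImmersion.lift U.ι κ hrange with hκ'
  have hfac : κ' ≫ U.ι = κ := IsOpenImmersion.lift_fac U.ι κ hrange
  haveI : IsClosedImmersion (κ' ≫ U.ι) := by rw [hfac]; infer_instance
  haveI : IsClosedImmersion κ' := IsClosedImmersion.of_comp κ' U.ι
  haveI : IsReduced (U : Scheme.{u}) := isReduced_of_isOpenImmersion U.ι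
  haveI : AlgebraicGeometry.Surjective κ' := by
    refine ⟨fun u => ?_⟩
    have hu : U.ι.base u ∈ (U : Set S) := by rw [← Scheme.Opens.range_ι]; exact ⟨u, rfl⟩
    obtain ⟨z, hz⟩ : U.ι.base u ∈ Set.range κ.base := hu
    refine ⟨z, U.ι.isOpenEmbedding.injective ?_⟩
    change (κ' ≫ U.ι).base z = U.ι.base u
    rw [hfac, hz]
  haveI : IsIso κ' := isIso_of_isClosedImmersion_of_surjective κ'
  rw [← hfac]
  infer_instance

/-! ### §3. The cofan of a finite disjoint closed cover of a reduced scheme is a colimit -/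

/-- **A reduced scheme covered by finitely many pairwise disjoint closed subschemes is their coproduct**: for closed immersions
`κ_i : Z_i ⟶ S` (`i ∈ σ` finite) with pairwise disjoint images covering the reduced scheme `S`, the cofan `(κ_i)` is a colimit,
`S ≅ ∐_i Z_i` (each `κ_i` is an open immersion by §§1–2; Mathlib `nonempty_isColimit_cofanMk_of`).
[cite: GortzWedhorn2020, §(3.5) Prop. 3.10 and Example 3.11] [cite: StacksProject, Tag 0F2M] -/
theorem nonempty_isColimit_cofan_of_isClosedImmersion {σ : Type u} [Finite σ] {Z : σ → Scheme.{u}} {S : Scheme.{u}}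
    [IsReduced S] (κ : ∀ i, Z i ⟶ S) [∀ i, IsClosedImmersion (κ i)]
    (hdisj : Pairwise (Disjoint on fun i => Set.range (κ i).base)) (hcov : ⋃ i, Set.range (κ i).base = Set.univ) :
    Nonempty (IsColimit (Cofan.mk S κ)) := by
  have hopen : ∀ i, IsOpen (Set.range (κ i).base) :=
    isOpen_of_finite_disjoint_closed_cover (fun i => Set.range (κ i).base) (fun i => (κ i).isClosedEmbedding.isClosed_range)
      hdisj hcov
  haveI : ∀ i, IsOpenImmersion (κ i) := fun i => isOpenImmersion_of_isClosedImmersion_of_isOpen_range (κ i) (hopen i)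
  refine nonempty_isColimit_cofanMk_of κ ?_ ?_
  · rw [eq_top_iff]
    rintro x -
    have hx : x ∈ ⋃ i, Set.range (κ i).base := by rw [hcov]; exact mem_univ x
    obtain ⟨i, hi⟩ := mem_iUnion.1 hx
    exact TopologicalSpace.Opens.mem_iSup.2 ⟨i, hi⟩
  · intro i j hij
    change Disjoint (κ i).opensRange (κ j).opensRange
    rw [← TopologicalSpace.Opens.coe_disjoint]
    exact hdisj hij

/-- **The same in `Over B`** (e.g. the tree's `SchemeOver k = Over (Spec k)`): a cofan of `B`-morphisms whose underlying morphisms are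
closed immersions with pairwise disjoint images covering the reduced apex is a colimit in `Over B` (`Over.forget B` creates, hence
reflects, coproducts). [cite: GortzWedhorn2020, §(3.5) Prop. 3.10 and Example 3.11] -/
theorem nonempty_isColimit_cofan_over_of_isClosedImmersion {σ : Type u} [Finite σ] {B : Scheme.{u}} {Z : σ → Over B}
    {S : Over B} [IsReduced S.left] (κ : ∀ i, Z i ⟶ S) [∀ i, IsClosedImmersion (κ i).left]
    (hdisj : Pairwise (Disjoint on fun i => Set.range (κ i).left.base))
    (hcov : ⋃ i, Set.range (κ i).left.base = Set.univ) :
    Nonempty (IsColimit (Cofan.mk S κ)) := by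
  obtain ⟨hS⟩ := nonempty_isColimit_cofan_of_isClosedImmersion (fun i => (κ i).left) hdisj hcov
  have h2 : IsColimit ((Over.forget B).mapCocone (Cofan.mk S κ)) :=
    (Cofan.isColimitMapCoconeEquiv (Over.forget B) Z (Cofan.mk S κ)).symm hS
  exact ⟨isColimitOfReflects (Over.forget B) h2⟩

end Literature.AlgebraicGeometry.Morphisms

end
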